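import Summits.ValiantsHypothesis.ValiantsHypothesis.Theorems.LacunarySymmetroidMatrixDescartesDoorA26WallBubblingHingeExclusion
import Summits.ValiantsHypothesis.ValiantsHypothesis.Theorems.LacunarySymmetroidMatrixDescartesDoorA26WallBubblingSecondOrderClusters
import Summits.ValiantsHypothesis.ValiantsHypothesis.Theorems.LacunarySymmetroidMatrixDescartesDoorA26WallBubblingHigherMinors
import Summits.ValiantsHypothesis.ValiantsHypothesis.Theorems.LacunarySymmetroidMatrixDescartesDoorA26WallBubblingTightIntervals

/-!
# Wall bubbling for `DoorA26` — obligation (R): the hinge exclusion AT INTERIOR POINTS, by name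

HONEST FRAMING.  Helper theorems for the line `Cruxes/DoorA26/Lines/wall_bubbling.lean` (crux stmt-ValiantsHypothesis-19979 `DoorA26`; OPEN, typed,
never asserted), W2 seat val-sym-door-p1 g16, obligation (R) `stub_chamberRigidity` («door-hard by design»: no accumulation of twenties at an interior
point of a chamber).  Door-free, def-free; nothing here bears on `DoorA26`, `MatrixDescartes` (stmt-ValiantsHypothesis-18050) or `VP ≠ VNP`.

WHAT IS PROVED.  The (B) machinery of the line (`Bubbling.ClusterLimit`, `Bubbling.clusterLimit_of_mem_closure`, val-idea-15 g1 / val-port-4 g1) attaches to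
every point `δ⋆` of the closure of the twenty-locus CLUSTER-LIMIT DATA: clusters `c` with `m c` zeros (`Σ m c = 20`), normalised recentred Grams
`a c ν → H c ≠ 0` realisable, and the exact TRANSFER `a c′ ν p = a c ν p · exp(x_p L) · ρ` between clusters.  W1's `SecondOrder.exists_clusterLimit_realisable_of_mem_closure`
(`…WallBubblingSecondOrderClusters`) supplies such data WITH the finite-stage realisability of every `a c ν` (the hypothesis `hrealν` below).  §2 feeds two clusters `c < c′` of such data into the two-slope
dictionary and the hinge exclusion of W2 #34/#35: **if a member `(b,cc)` is alive in BOTH limits `H c`, `H c′` (a hinge), letters `a, d` with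
`δ⋆ a < δ⋆ b < δ⋆ cc < δ⋆ d` exist, the member `(a,d)` is alive in the limit on its side of the hinge, and no other member shares the hinge value, then
FALSE** (`interior_hinge_exclusion`).  No tightness, no Weyl/mixed structure and no door is assumed: the statement holds at every `δ⋆` (interior or wall);
at a generic interior point a two-cluster degeneration is a tight chain whose hinge members are alive and whose every member is alive, so this excludes the
hinges `δ_p + δ_q`, `0 < p < q < 5` there (located census: 15 648/15 648, kit j321716) — §3 `interior_twoChain_hinge_not_between` proves exactly this
for TWO-cluster data (tightness from `Σ m = 20 ≤ Σ(|Λ_c|−1) ≤ |V| − 1 = 20`, coverage from W2 #28 `interval_count_tight`, sides from `tropical_monotone`).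

[folklore] Bolzano–Weierstrass bookkeeping (copied), limits; [this work] the wiring.
-/

-- `Summit.ValiantsHypothesis.ValiantsHypothesis.…` repeats a component by the D-0017 layout
-- (single-conjunct summit), which the `dupNamespace` linter flags; the name is mandated.
set_option linter.dupNamespace false

namespace Summit.ValiantsHypothesis.ValiantsHypothesis.Theorems.LacunarySymmetroidMatrixDescartes.WallBubbling.Bubbling

open Finset Filter Topology

/-! ## §2 The hinge exclusion at a closure point, in cluster-limit currency -/

/-- A realisable matrix is symmetric. [folklore] -/
theorem realisable_apply_symm {G : Matrix (Fin 6) (Fin 6) ℝ} (hG : Realisable G) (i j : Fin 6) : G i j = G j i := by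
  obtain ⟨ε, S, -, -, h⟩ := hG
  rw [h, h, polar_comm]

/-- **INTERIOR HINGE EXCLUSION (obligation (R) currency).**  Cluster-limit data `D` at `δ⋆` with finite-stage realisability; two clusters
`c < c′`; four letters `e = (a,b,cc,d)` with `δ⋆ a < δ⋆ b < δ⋆ cc < δ⋆ d`; the member `(b,cc)` ALIVE IN BOTH limits `H c`, `H c′` (a hinge) and no
other member sharing its value at `δ⋆`; the member `(a,d)` alive in the limit on its side (`H c` if `δ⋆a+δ⋆d < δ⋆b+δ⋆cc`, else `H c′`).  Then `False`.
Proof: pass to a tail on which every member keeps the side of its limit value, read `D.a c ν` as the Gram sequence with centres `0 < L c c′ ν`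
(transfer identity ⇒ the cluster-`c′` package), and apply `false_of_hinge_strictly_between_of_packages` (W2 #35) with the vanishing principal minor
from `realisable_det_submatrix` (W1 #21). [this work] -/
theorem interior_hinge_exclusion {δstar : Fin 6 → ℝ} (D : ClusterLimit δstar)
    (hrealν : ∀ c ν, Realisable (Matrix.of fun k l => D.a c ν (k, l)))
    (c c' : Fin D.C) (hcc' : c < c') (e : Fin 4 → Fin 6)
    (hab : δstar (e 0) < δstar (e 1)) (hbc : δstar (e 1) < δstar (e 2)) (hcd : δstar (e 2) < δstar (e 3))
    (hgen : ∀ p q : Fin 6, δstar p + δstar q = δstar (e 1) + δstar (e 2) → (p = e 1 ∧ q = e 2) ∨ (p = e 2 ∧ q = e 1))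
    (hh : D.H c (e 1, e 2) ≠ 0) (hh' : D.H c' (e 1, e 2) ≠ 0)
    (had : (δstar (e 0) + δstar (e 3) < δstar (e 1) + δstar (e 2) ∧ D.H c (e 0, e 3) ≠ 0) ∨
           (δstar (e 1) + δstar (e 2) < δstar (e 0) + δstar (e 3) ∧ D.H c' (e 0, e 3) ≠ 0)) : False := by
  classical
  -- symmetry of the limits
  have hsym : ∀ c₀ p q, D.H c₀ (p, q) = D.H c₀ (q, p) := by
    intro c₀ p q
    have := realisable_apply_symm (D.hreal c₀) p q
    simpa using this
  -- values and their limits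
  set v : ℝ := δstar (e 1) + δstar (e 2) with hv
  have hw : ∀ p q : Fin 6, Tendsto (fun ν => D.δseq ν p + D.δseq ν q) atTop (𝓝 (δstar p + δstar q)) :=
    fun p q => (D.hδ p).add (D.hδ q)
  have hvν : Tendsto (fun ν => D.δseq ν (e 1) + D.δseq ν (e 2)) atTop (𝓝 v) := hw _ _
  -- a tail on which every member keeps its side
  have hside : ∀ᶠ ν in atTop, ∀ pq : Fin 6 × Fin 6,
      (δstar pq.1 + δstar pq.2 < v → D.δseq ν pq.1 + D.δseq ν pq.2 ≤ D.δseq ν (e 1) + D.δseq ν (e 2)) ∧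
      (v < δstar pq.1 + δstar pq.2 → D.δseq ν (e 1) + D.δseq ν (e 2) ≤ D.δseq ν pq.1 + D.δseq ν pq.2) := by
    refine eventually_all.mpr fun pq => ?_
    refine Filter.Eventually.and ?_ ?_
    · by_cases hlt : δstar pq.1 + δstar pq.2 < v
      · have := ((hw pq.1 pq.2).sub hvν).eventually (gt_mem_nhds (sub_neg.mpr hlt))
        exact this.mono fun ν hν _ => by linarith
      · exact Eventually.of_forall fun ν h => absurd h hlt
    · by_cases hgt : v < δstar pq.1 + δstar pq.2
      · have := ((hw pq.1 pq.2).sub hvν).eventually (lt_mem_nhds (sub_pos.mpr hgt))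
        exact this.mono fun ν hν _ => by linarith
      · exact Eventually.of_forall fun ν h => absurd h hgt
  obtain ⟨N₀, hN₀⟩ := eventually_atTop.mp hside
  -- the shifted data
  have hshift : Tendsto (fun ν : ℕ => ν + N₀) atTop atTop := tendsto_add_atTop_nat N₀
  refine false_of_hinge_strictly_between_of_packages
    (fun ν => Matrix.of fun k l => D.a c (ν + N₀) (k, l)) e ?_
    (fun ν => D.δseq (ν + N₀)) δstar (fun l => (D.hδ l).comp hshift) hab hbc hcd
    (fun _ => 0) (fun ν => D.L c c' (ν + N₀)) (fun _ => 1) (fun ν => (D.ρ c c' (ν + N₀))⁻¹)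
    (fun _ => one_pos) (fun ν => inv_pos.mpr (D.hρ c c' _)) ?_
    (fun p q => D.H c (p, q)) (fun p q => D.H c' (p, q)) (fun p q => δstar p + δstar q ≤ v) ?_ ?_ ?_ ?_ ?_ ?_ hh hh' ?_
  · -- vanishing principal minors (rank ≤ 3 at every stage)
    intro ν
    exact SecondOrder.realisable_det_submatrix (hrealν c (ν + N₀)) (by norm_num) e e
  · -- the gap diverges
    have h := (D.hL c c' hcc').comp hshift
    simp only [sub_zero]
    exact h
  · -- sides, below
    intro p q hB ν
    rcases lt_or_eq_of_le hB with hlt | heq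
    · exact (hN₀ (ν + N₀) (Nat.le_add_left _ _) (p, q)).1 hlt
    · rcases hgen p q heq with ⟨rfl, rfl⟩ | ⟨rfl, rfl⟩
      · exact le_rfl
      · exact (add_comm _ _).le
  · -- sides, above
    intro p q hB ν
    have hgt : v < δstar p + δstar q := lt_of_not_ge hB
    exact (hN₀ (ν + N₀) (Nat.le_add_left _ _) (p, q)).2 hgt
  · -- package of cluster c (centre 0, normaliser 1)
    intro p q _
    have := (D.ha c (p, q)).comp hshift
    refine this.congr' (Eventually.of_forall fun ν => ?_)
    simp
  · -- package of cluster c′ through the transfer identity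
    intro p q _
    have := (D.ha c' (p, q)).comp hshift
    refine this.congr' (Eventually.of_forall fun ν => ?_)
    simp only [Function.comp_apply, Matrix.of_apply, div_inv_eq_mul]
    rw [D.htransfer c c' hcc' (ν + N₀) (p, q)]
    simp [pairExp]
  · -- hinge limit at c
    have := (D.ha c (e 1, e 2)).comp hshift
    refine this.congr' (Eventually.of_forall fun ν => ?_)
    simp
  · -- hinge limit at c′
    have := (D.ha c' (e 1, e 2)).comp hshift
    refine this.congr' (Eventually.of_forall fun ν => ?_)
    simp only [Function.comp_apply, Matrix.of_apply, div_inv_eq_mul]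
    rw [D.htransfer c c' hcc' (ν + N₀) (e 1, e 2)]
    simp [pairExp]
  · -- aliveness of the four members of the order-reversing matching
    intro pq hpq
    simp only [List.mem_cons, List.not_mem_nil, or_false] at hpq
    have hvle : δstar (e 1) + δstar (e 2) ≤ v := le_rfl
    have hvle' : δstar (e 2) + δstar (e 1) ≤ v := (add_comm _ _).le
    rcases hpq with rfl | rfl | rfl | rfl
    · -- (e 3, e 0)
      rcases had with ⟨hlt, hne⟩ | ⟨hgt, hne⟩
      · left; exact ⟨by simp only; linarith, by rw [hsym]; exact hne⟩
      · right; exact ⟨by simp only; push Not; linarith, by rw [hsym]; exact hne⟩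
    · left; exact ⟨hvle', by rw [hsym]; exact hh⟩
    · left; exact ⟨hvle, hh⟩
    · rcases had with ⟨hlt, hne⟩ | ⟨hgt, hne⟩
      · left; exact ⟨by simp only; linarith, hne⟩
      · right; exact ⟨by simp only; push Not; linarith, hne⟩


/-! ## §3 Generic interior points: tightness and the two-cluster hinge classification -/

/-- At a point with 21 distinct pair-sum values (genericity), the class of the value `δ⋆p + δ⋆q` of a SYMMETRIC member vector `H` is alive iff the
member `(p,q)` is non-zero. [this work] -/
theorem classSum_ne_zero_iff_of_generic {δstar : Fin 6 → ℝ}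
    (hgen : ∀ p q p' q' : Fin 6, δstar p + δstar q = δstar p' + δstar q' → (p = p' ∧ q = q') ∨ (p = q' ∧ q = p'))
    (H : Pair → ℝ) (hsym : ∀ p q, H (p, q) = H (q, p)) (p q : Fin 6) :
    classSum H (pairExp δstar) (δstar p + δstar q) ≠ 0 ↔ H (p, q) ≠ 0 := by
  classical
  unfold classSum pairExp
  by_cases hpq : p = q
  · subst hpq
    rw [Finset.sum_eq_single (p, p)]
    · simp
    · rintro ⟨i, j⟩ - hij
      rw [if_neg]
      intro h
      rcases hgen i j p p h with ⟨rfl, rfl⟩ | ⟨rfl, rfl⟩ <;> exact hij rfl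
    · intro h; exact absurd (Finset.mem_univ _) h
  · rw [Finset.sum_eq_add (p, q) (q, p) (by intro h; exact hpq (Prod.ext_iff.mp h).1)]
    · rw [if_pos rfl, if_pos (by simp only; ring), hsym q p, ← two_mul]
      simp
    · rintro ⟨i, j⟩ - ⟨h1, h2⟩
      rw [if_neg]
      intro h
      rcases hgen i j p q h with ⟨rfl, rfl⟩ | ⟨rfl, rfl⟩
      · exact h1 rfl
      · exact h2 rfl
    · intro h; exact absurd (Finset.mem_univ _) h
    · intro h; exact absurd (Finset.mem_univ _) h

/-- At a generic point the 36 ordered members take exactly 21 values. [folklore] -/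
theorem card_pairSums_eq_of_generic {δstar : Fin 6 → ℝ}
    (hgen : ∀ p q p' q' : Fin 6, δstar p + δstar q = δstar p' + δstar q' → (p = p' ∧ q = q') ∨ (p = q' ∧ q = p')) :
    (Finset.univ.image (fun pq : Fin 6 × Fin 6 => δstar pq.1 + δstar pq.2)).card = 21 := by
  classical
  -- the values are in bijection with the unordered pairs `p ≤ q`
  have h : Finset.univ.image (fun pq : Fin 6 × Fin 6 => δstar pq.1 + δstar pq.2)
      = (Finset.univ.filter fun pq : Fin 6 × Fin 6 => pq.1 ≤ pq.2).image (fun pq => δstar pq.1 + δstar pq.2) := by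
    ext w
    simp only [Finset.mem_image, Finset.mem_univ, true_and, Finset.mem_filter]
    constructor
    · rintro ⟨⟨i, j⟩, rfl⟩
      rcases le_total i j with hij | hij
      · exact ⟨(i, j), hij, rfl⟩
      · exact ⟨(j, i), hij, by simp only; ring⟩
    · rintro ⟨pq, -, rfl⟩; exact ⟨pq, rfl⟩
  rw [h, Finset.card_image_of_injOn]
  · decide
  · rintro ⟨i, j⟩ hij ⟨i', j'⟩ hij' heq
    simp only [Finset.coe_filter, Finset.mem_univ, true_and, Set.mem_setOf_eq] at hij hij'
    rcases hgen i j i' j' heq with ⟨rfl, rfl⟩ | ⟨rfl, rfl⟩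
    · rfl
    · have : i = j := le_antisymm hij hij'
      subst this; rfl

/-- **HINGE EXCLUSION FOR ANY TWO CLUSTERS, aliveness in class-sum currency** (no tightness needed).  Cluster-limit data with finite-stage
realisability at a point with 21 distinct pair-sum values; clusters `c < c′`; letters with `δ⋆a < δ⋆p < δ⋆q < δ⋆d`; the value `δ⋆p + δ⋆q` alive in
BOTH cluster limits and the value `δ⋆a + δ⋆d` alive in ONE of the two.  Contradiction (its side is forced by `tropical_monotone`, then
`interior_hinge_exclusion`).  For consecutive clusters of a tight chain at a generic interior point the first two aliveness hypotheses say «hinge», the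
third says «`δ⋆a+δ⋆d` lies in `Λ_c ∪ Λ_{c′}`». [this work] -/
theorem interior_hinge_not_between_of_alive {δstar : Fin 6 → ℝ} (D : ClusterLimit δstar)
    (hrealν : ∀ c ν, Realisable (Matrix.of fun k l => D.a c ν (k, l)))
    (hgen : ∀ p q p' q' : Fin 6, δstar p + δstar q = δstar p' + δstar q' → (p = p' ∧ q = q') ∨ (p = q' ∧ q = p'))
    (c c' : Fin D.C) (hcc' : c < c')
    (a p q d : Fin 6) (hap : δstar a < δstar p) (hpq : δstar p < δstar q) (hqd : δstar q < δstar d)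
    (h0 : classSum (D.H c) (pairExp δstar) (δstar p + δstar q) ≠ 0)
    (h1 : classSum (D.H c') (pairExp δstar) (δstar p + δstar q) ≠ 0)
    (had : classSum (D.H c) (pairExp δstar) (δstar a + δstar d) ≠ 0 ∨ classSum (D.H c') (pairExp δstar) (δstar a + δstar d) ≠ 0) :
    False := by
  classical
  have hsym : ∀ c₀ i j, D.H c₀ (i, j) = D.H c₀ (j, i) := by
    intro c₀ i j
    have := realisable_apply_symm (D.hreal c₀) i j
    simpa using this
  have hx : ∀ pq : Pair, Tendsto (fun ν => pairExp (D.δseq ν) pq) atTop (𝓝 (pairExp δstar pq)) :=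
    fun pq => (D.hδ pq.1).add (D.hδ pq.2)
  -- monotonicity between the two clusters, member-wise (B8)
  have hmono : ∀ pq pq' : Pair, D.H c pq ≠ 0 → D.H c' pq' ≠ 0 → pairExp δstar pq ≤ pairExp δstar pq' := by
    intro pq pq' hH hH'
    exact tropical_monotone (fun ν => pairExp (D.δseq ν)) (D.a c) (D.a c') (pairExp δstar) (D.H c) (D.H c')
      (D.L c c') (D.ρ c c') hx (D.ha c) (D.ha c') (D.hbound c) (D.hbound c') (D.hρ c c') (D.hL c c' hcc')
      (D.htransfer c c' hcc') hH hH'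
  have hh0 : D.H c (p, q) ≠ 0 := (classSum_ne_zero_iff_of_generic hgen (D.H c) (hsym c) p q).mp h0
  have hh1 : D.H c' (p, q) ≠ 0 := (classSum_ne_zero_iff_of_generic hgen (D.H c') (hsym c') p q).mp h1
  have hne_ad : δstar a + δstar d ≠ δstar p + δstar q := by
    intro h
    rcases hgen a d p q h with ⟨rfl, rfl⟩ | ⟨rfl, rfl⟩
    · exact lt_irrefl _ hap
    · exact lt_irrefl _ (hpq.trans hqd)
  have had' : (δstar a + δstar d < δstar p + δstar q ∧ D.H c (a, d) ≠ 0) ∨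
      (δstar p + δstar q < δstar a + δstar d ∧ D.H c' (a, d) ≠ 0) := by
    rcases had with h | h
    · have hal : D.H c (a, d) ≠ 0 := (classSum_ne_zero_iff_of_generic hgen (D.H c) (hsym c) a d).mp h
      have hle : δstar a + δstar d ≤ δstar p + δstar q := hmono (a, d) (p, q) hal hh1
      exact Or.inl ⟨lt_of_le_of_ne hle hne_ad, hal⟩
    · have hal : D.H c' (a, d) ≠ 0 := (classSum_ne_zero_iff_of_generic hgen (D.H c') (hsym c') a d).mp h
      have hle : δstar p + δstar q ≤ δstar a + δstar d := hmono (p, q) (a, d) hh0 hal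
      exact Or.inr ⟨lt_of_le_of_ne hle hne_ad.symm, hal⟩
  refine interior_hinge_exclusion D hrealν c c' hcc' ![a, p, q, d] (by simpa using hap) (by simpa using hpq)
    (by simpa using hqd) ?_ (by simpa using hh0) (by simpa using hh1) (by simpa using had')
  intro p' q' h
  simp only [Matrix.cons_val_one, Matrix.head_cons, Matrix.cons_val_two, Matrix.tail_cons] at h ⊢
  exact hgen p' q' p q h

/-- **TWO-CLUSTER HINGE CLASSIFICATION AT A GENERIC INTERIOR POINT (obligation (R), by name).**  Cluster-limit data with finite-stage realisability
at a point `δ⋆` with 21 distinct pair-sum values, exactly TWO clusters, and a value `δ⋆p + δ⋆q` alive in both cluster limits (the hinge) with letters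
strictly below `p` and strictly above `q` in `δ⋆`-order: contradiction.  Hence the hinge of a two-cluster degeneration of twenties at a generic interior
point is a value `δ⋆p + δ⋆q` with `p` the lowest letter, or `q` the highest letter, or `p = q` (located census: the middle survivors `δ₀+δ_q`, `δ_p+δ₅`,
`2δ_p`; 15 648/15 648 of the other hinges die, kit j321716).  Proof: the chain is tight (`Σ m = 20 ≤ Σ(|Λ_c|−1) ≤ |V| − 1 = 20`), so by `interval_count_tight`
(W2 #28) the value `δ⋆a + δ⋆d` is alive in one of the two clusters; then `interior_hinge_not_between_of_alive`. [this work] -/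
theorem interior_twoChain_hinge_not_between {δstar : Fin 6 → ℝ} (D : ClusterLimit δstar)
    (hrealν : ∀ c ν, Realisable (Matrix.of fun k l => D.a c ν (k, l)))
    (hC : D.C = 2)
    (hgen : ∀ p q p' q' : Fin 6, δstar p + δstar q = δstar p' + δstar q' → (p = p' ∧ q = q') ∨ (p = q' ∧ q = p'))
    (a p q d : Fin 6) (hap : δstar a < δstar p) (hpq : δstar p < δstar q) (hqd : δstar q < δstar d)
    (h0 : classSum (D.H ⟨0, by omega⟩) (pairExp δstar) (δstar p + δstar q) ≠ 0)
    (h1 : classSum (D.H ⟨1, by omega⟩) (pairExp δstar) (δstar p + δstar q) ≠ 0) : False := by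
  classical
  set c₀ : Fin D.C := ⟨0, by omega⟩ with hc₀
  set c₁ : Fin D.C := ⟨1, by omega⟩ with hc₁
  have hc01 : c₀ < c₁ := by rw [hc₀, hc₁]; exact Fin.mk_lt_mk.mpr zero_lt_one
  have hcases : ∀ c : Fin D.C, c = c₀ ∨ c = c₁ := by
    intro c
    have := c.isLt
    rcases Nat.lt_or_ge c.val 1 with h | h
    · left; exact Fin.ext (by rw [hc₀]; simp only; omega)
    · right; exact Fin.ext (by rw [hc₁]; simp only; omega)
  have hsym : ∀ c i j, D.H c (i, j) = D.H c (j, i) := by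
    intro c i j
    have := realisable_apply_symm (D.hreal c) i j
    simpa using this
  -- the value set and the active sets (as in `count_absurd`)
  set V : Finset ℝ := Finset.univ.image (fun pq : Fin 6 × Fin 6 => δstar pq.1 + δstar pq.2) with hVdef
  have hVcard : V.card = 21 := card_pairSums_eq_of_generic hgen
  have hx : ∀ pq : Pair, Tendsto (fun ν => pairExp (D.δseq ν) pq) atTop (𝓝 (pairExp δstar pq)) :=
    fun pq => (D.hδ pq.1).add (D.hδ pq.2)
  have hmemV : ∀ c w, classSum (D.H c) (pairExp δstar) w ≠ 0 → w ∈ V := by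
    intro c w hw
    obtain ⟨pq, hpq', -⟩ := exists_member_of_classSum_ne_zero (D.H c) (pairExp δstar) w hw
    rw [hVdef, Finset.mem_image]
    exact ⟨pq, Finset.mem_univ _, hpq'⟩
  set Λ : Fin D.C → Finset ℝ := fun c => V.filter fun w => classSum (D.H c) (pairExp δstar) w ≠ 0 with hΛdef
  have hΛmem : ∀ c w, w ∈ Λ c ↔ classSum (D.H c) (pairExp δstar) w ≠ 0 := by
    intro c w
    rw [hΛdef, Finset.mem_filter]
    exact ⟨fun h => h.2, fun h => ⟨hmemV c w h, h⟩⟩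
  have hΛsub : ∀ c, Λ c ⊆ V := fun c => Finset.filter_subset _ _
  -- every cluster is active (no blow-up at a generic point)
  have hact : ∀ c, ∃ w, classSum (D.H c) (pairExp δstar) w ≠ 0 := by
    intro c
    have hH := D.hH c
    have : ∃ pq, D.H c pq ≠ 0 := by
      by_contra hall
      push Not at hall
      exact hH (funext hall)
    obtain ⟨⟨i, j⟩, hij⟩ := this
    exact ⟨δstar i + δstar j, (classSum_ne_zero_iff_of_generic hgen (D.H c) (hsym c) i j).mpr hij⟩
  have hΛne : ∀ c, (Λ c).Nonempty := by
    intro c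
    obtain ⟨w, hw⟩ := hact c
    exact ⟨w, (hΛmem c w).mpr hw⟩
  have hcount : ∀ c, D.m c + 1 ≤ (Λ c).card := by
    intro c
    have hev := robust_term_count' (D.a c) (fun ν => pairExp (D.δseq ν)) (D.H c) (pairExp δstar) (Λ c)
      (D.ha c) hx (fun w hw => (hΛmem c w).mpr hw) (hact c) (D.R c)
    obtain ⟨ν, hν⟩ := hev.exists
    obtain ⟨Z, hZcard, hZ⟩ := D.hzeros c ν
    have := hν Z hZ
    omega
  have hmono : ∀ c c', c < c' → ∀ w ∈ Λ c, ∀ w' ∈ Λ c', w ≤ w' := by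
    intro c c' hcc' w hw w' hw'
    obtain ⟨pq, hpq', hHp⟩ := exists_member_of_classSum_ne_zero (D.H c) (pairExp δstar) w ((hΛmem c w).mp hw)
    obtain ⟨pq', hpq'', hHp'⟩ := exists_member_of_classSum_ne_zero (D.H c') (pairExp δstar) w' ((hΛmem c' w').mp hw')
    have := tropical_monotone (fun ν => pairExp (D.δseq ν)) (D.a c) (D.a c') (pairExp δstar) (D.H c) (D.H c')
      (D.L c c') (D.ρ c c') hx (D.ha c) (D.ha c') (D.hbound c) (D.hbound c') (D.hρ c c') (D.hL c c' hcc')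
      (D.htransfer c c' hcc') hHp hHp'
    rw [hpq', hpq''] at this
    exact this
  have hint : ∑ c, ((Λ c).card - 1) ≤ V.card - 1 := interval_count V Λ hΛne hΛsub hmono
  have hsum : ∑ c, D.m c ≤ ∑ c, ((Λ c).card - 1) :=
    Finset.sum_le_sum fun c _ => by have := hcount c; omega
  have h20 := D.hm
  have htight : ∑ c, ((Λ c).card - 1) = V.card - 1 := by omega
  -- coverage (equality case of B9): the value `δ⋆a + δ⋆d` is alive in some cluster, which is `c₀` or `c₁`
  obtain ⟨hcover, -, -⟩ := interval_count_tight V Λ hΛne hΛsub hmono (by omega) htight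
  have hadV : δstar a + δstar d ∈ V := by
    rw [hVdef, Finset.mem_image]; exact ⟨(a, d), Finset.mem_univ _, rfl⟩
  obtain ⟨c, hc⟩ := hcover _ hadV
  have had : classSum (D.H c₀) (pairExp δstar) (δstar a + δstar d) ≠ 0 ∨
      classSum (D.H c₁) (pairExp δstar) (δstar a + δstar d) ≠ 0 := by
    rcases hcases c with rfl | rfl
    · exact Or.inl ((hΛmem _ _).mp hc)
    · exact Or.inr ((hΛmem _ _).mp hc)
  exact interior_hinge_not_between_of_alive D hrealν hgen c₀ c₁ hc01 a p q d hap hpq hqd h0 h1 had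

end Summit.ValiantsHypothesis.ValiantsHypothesis.Theorems.LacunarySymmetroidMatrixDescartes.WallBubbling.Bubbling
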